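import Summits.QuantumFields.YangMills.Theorems.ComplexCouplingChannelTubeZeroFreeChannelStubTubeRate
import Summits.QuantumFields.YangMills.Theorems.ComplexCouplingChannelComplexStrongCouplingAnchor
import Literature.MathematicalPhysics.QuantumFieldTheory.PeriodicBoxFreeEnergyLimits
import HarnessLib

/-!
# Engine of `TubeZeroFreeChannel`, part 1: the strong-coupling anchor with a HOLOMORPHIC tube rate

Crux `TubeZeroFreeChannel` (item stmt-QuantumFields-18841, route `ComplexCouplingChannel` of
`QuantumFields/YangMills`), strategist certificate, file 1 of 3 (`…EngineAnchor`, `…EngineChain`, `…EngineGap`).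

* `exists_holomorphic_tube_rate`: on the strong-coupling disc `‖z‖ < ρ₀` the Kotecký–Preiss logarithm
  `ℓ_{L,t} = log Zc(·; L, t)` of the box partition function `boxZ r · L t` is holomorphic with
  `‖ℓ_{L,t} − t e_L‖ ≤ K_L e^{−t/4}` for a HOLOMORPHIC tube rate `e_L` (uniform limit of `ℓ_{L,t}/t`): the tree's
  `exists_tube_rate` (in-proof form of the route's `ComplexStrongCouplingAnchor`, item 18843) plus
  `PlaqSystem.differentiableOn_pertLogZ`.
* three small complex-analysis helpers used by the chain continuation of part 2 (derivative and uniqueness of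
  holomorphic logarithms, a local Borel–Carathéodory bound).

References: K. Osterwalder, E. Seiler, Ann. Phys. 110 (1978) §3; E. Seiler, LNP 159 (1982) Ch. 3;
R. Kotecký, D. Preiss, CMP 103 (1986); Mathlib `Complex.borelCaratheodory_zero`.
-/

set_option autoImplicit false

noncomputable section

open scoped Topology
open Filter Metric Set Complex MeasureTheory
open Literature.MathematicalPhysics.QuantumFieldTheory
open Literature.Probability.LatticeModels
open Summit.QuantumFields.YangMills.Theorems.TubeZeroFreeChannel.Negative (boxZ boxZ_eq_partZ)

namespace Summit.QuantumFields.YangMills.Theorems.TubeZeroFreeChannel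

/-! ### E1. The strong-coupling anchor with a holomorphic tube rate -/

section Anchor

variable {G : Type} [Group G] [TopologicalSpace G] [IsTopologicalGroup G] [CompactSpace G]
  [MeasurableSpace G] [BorelSpace G]

/-- **Holomorphic tube rate on the strong-coupling disc.** For every lattice representation `r` there is
`ρ₀ > 0` such that for every cross-section `L ≥ 1` the box partition functions `Zc(·; L, t) = boxZ r · L t`,
`t ≥ 1`, have holomorphic logarithms `ℓ t` on `‖z‖ < ρ₀` with `‖ℓ t z − t·e z‖ ≤ K e^{−t/4}` for ONE holomorphic
tube rate `e = e_L` (Kotecký–Preiss logarithm of the Osterwalder–Seiler polymer expansion; the `t → ∞` limit is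
uniform, whence holomorphic). [cite: SeilerLNP1982, Ch. 3] -/
theorem exists_holomorphic_tube_rate (r : LatticeRep G) :
    ∃ ρ₀ : ℝ, 0 < ρ₀ ∧ ∀ L : ℕ, 1 ≤ L → ∃ K : ℝ, ∃ e : ℂ → ℂ, DifferentiableOn ℂ e (ball 0 ρ₀) ∧
      ∃ ℓ : ℕ → ℂ → ℂ, ∀ t : ℕ, 1 ≤ t → DifferentiableOn ℂ (ℓ t) (ball 0 ρ₀) ∧
        ∀ z ∈ ball (0 : ℂ) ρ₀, exp (ℓ t z) = boxZ r z L t ∧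
          ‖ℓ t z - (t : ℂ) * e z‖ ≤ K * Real.exp (-(1 / 4 * (t : ℝ))) := by
  classical
  have hM : 0 < costBound r.ρ := costBound_pos r.ρ
  set M : ℝ := costBound r.ρ with hMdef
  set ρ₀ : ℝ := (Real.exp 2 * (4 * M) * ((boxDeg 4 : ℝ) + 1) ^ 2)⁻¹ with hρ₀def
  have hden : 0 < Real.exp 2 * (4 * M) * ((boxDeg 4 : ℝ) + 1) ^ 2 := by positivity
  have hρ₀ : 0 < ρ₀ := inv_pos.2 hden
  have hρ2 : Real.exp 2 * (2 * M * ρ₀) * ((boxDeg 4 : ℝ) + 1) ^ 2 ≤ 1 / 2 := by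
    rw [hρ₀def]; field_simp; norm_num
  have hρM : ρ₀ * M ≤ 1 := by
    have h1 : (1 : ℝ) ≤ Real.exp 2 := Real.one_le_exp (by norm_num)
    have h2 : (1 : ℝ) ≤ ((boxDeg 4 : ℝ) + 1) ^ 2 := one_le_pow₀ (by simp)
    rw [hρ₀def, inv_mul_le_iff₀ hden]
    nlinarith [mul_le_mul h1 h2 zero_le_one (by positivity)]
  have hρ1 : Real.exp 1 * (2 * M * ρ₀) * ((boxDeg 4 : ℝ) + 1) ^ 2 ≤ 1 / 2 :=
    PlaqSystem.smallness_one_of_two (D := boxDeg 4) (ε := 2 * M * ρ₀) (by positivity) hρ2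
  have hdisc : ∀ z : ℂ, ‖z‖ ≤ ρ₀ → ‖z‖ * M ≤ 1 ∧
      Real.exp 2 * (2 * M * ‖z‖) * ((boxDeg 4 : ℝ) + 1) ^ 2 ≤ 1 / 2 ∧
      Real.exp 1 * (2 * M * ‖z‖) * ((boxDeg 4 : ℝ) + 1) ^ 2 ≤ 1 / 2 := fun z hz =>
    disc_hypotheses (D := boxDeg 4) hM (r := ρ₀) hρM hρ2 hz
  refine ⟨ρ₀, hρ₀, fun L hL => ?_⟩
  have ha : 0 < L := hL
  -- the Kotecký–Preiss logarithms of the tubes `L³ × t`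
  set ℓ : ℕ → ℂ → ℂ := fun t z => pertLogZ (zdHaar 4 G)
    ((boxSystem (G := G) r.ρ (![L, L, L, t] : Fin 4 → ℕ)).weight z)
    (boxSystem (G := G) r.ρ (![L, L, L, t] : Fin 4 → ℕ)).Adj Finset.univ with hℓ
  -- the rate: the uniform limit of `ℓ (k+1) / (k+1)` on the closed disc
  set u : ℕ → ℂ → ℂ := fun k z => ℓ (k + 1) z / ((k + 1 : ℕ) : ℂ) with hu
  set b : ℕ → ℝ := fun k => 12 * (L : ℝ) ^ 3 * Real.exp (-(((k + 1) / 2 : ℕ) : ℝ)) with hb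
  have hcauchy : ∀ z ∈ closedBall (0 : ℂ) ρ₀, ∀ N k k', N ≤ k → N ≤ k' → ‖u k z - u k' z‖ ≤ b N := by
    intro z hz N k k' hk hk'
    rw [mem_closedBall, dist_zero_right] at hz
    obtain ⟨hzM, hz2, -⟩ := hdisc z hz
    have key : ∀ k k' : ℕ, N ≤ k → k ≤ k' → ‖u k z - u k' z‖ ≤ b N := by
      intro k k' hk hkk'
      have h : ‖u k z - u k' z‖ ≤ 12 * (L : ℝ) ^ 3 * Real.exp (-(((k + 1) / 2 : ℕ) : ℝ)) :=
        norm_pertLogZ_tube_div_sub_div_le (G := G) r.continuous hzM hz2 ha (t := k + 1) (t' := k' + 1)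
          (by omega) (by omega)
      exact h.trans (mul_le_mul_of_nonneg_left (exp_neg_floor_half_le (by omega)) (by positivity))
    rcases le_total k k' with h | h
    · exact key k k' hk h
    · rw [norm_sub_rev]; exact key k' k hk' h
  obtain ⟨e, he, hunif⟩ := exists_tendstoUniformlyOn_of_cauchy_bound (u := u) (b := b)
    (tendsto_exp_neg_half_floor _) hcauchy
  set K : ℝ := 48 * Real.exp 1 * (L : ℝ) ^ 3 with hK
  refine ⟨K, e, ?_, ℓ, fun t ht => ⟨?_, fun z hz => ⟨?_, ?_⟩⟩⟩
  · -- holomorphy of the rate: locally uniform limit of holomorphic functions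
    have hdiff : ∀ k, DifferentiableOn ℂ (u k) (ball 0 ρ₀) := by
      intro k
      have hR := boxSystem_regular (d := 4) (G := G) r.ρ r.continuous (![L, L, L, k + 1] : Fin 4 → ℕ)
      exact (PlaqSystem.differentiableOn_pertLogZ hR (r := ρ₀) hρM hρ1 Finset.univ).div_const _
    exact (hunif.mono ball_subset_closedBall).tendstoLocallyUniformlyOn.differentiableOn
      (Eventually.of_forall hdiff) isOpen_ball
  · -- holomorphy of the logarithms
    have hR := boxSystem_regular (d := 4) (G := G) r.ρ r.continuous (![L, L, L, t] : Fin 4 → ℕ)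
    exact PlaqSystem.differentiableOn_pertLogZ hR (r := ρ₀) hρM hρ1 Finset.univ
  · -- `exp ℓ = Zc`
    rw [mem_ball, dist_zero_right] at hz
    obtain ⟨hzM, -, hz1⟩ := hdisc z hz.le
    have hR := boxSystem_regular (d := 4) (G := G) r.ρ r.continuous (![L, L, L, t] : Fin 4 → ℕ)
    rw [boxZ_eq_partZ]
    exact PlaqSystem.exp_pertLogZ_eq_partZ hR hzM hz1 Finset.univ
  · -- the exponential bound
    obtain ⟨k, rfl⟩ : ∃ k, t = k + 1 := ⟨t - 1, by omega⟩
    have hz' : z ∈ closedBall (0 : ℂ) ρ₀ := ball_subset_closedBall hz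
    have h1 : ‖u k z - e z‖ ≤ b k := he z hz' k
    have hk0 : ((k + 1 : ℕ) : ℂ) ≠ 0 := by exact_mod_cast (show k + 1 ≠ 0 by omega)
    have h2 := norm_sub_mul_le_of_norm_div_sub_le hk0 h1
    rw [Complex.norm_natCast] at h2
    refine h2.trans ?_
    calc ((k + 1 : ℕ) : ℝ) * b k
        = 12 * (L : ℝ) ^ 3 * ((k + 1 : ℕ) : ℝ) * Real.exp (-(((k + 1) / 2 : ℕ) : ℝ)) := by rw [hb]; ring
      _ ≤ 12 * (L : ℝ) ^ 3 * ((k + 1 : ℕ) : ℝ) * (Real.exp 1 * Real.exp (-(1 / 4 * ((k + 1 : ℕ) : ℝ))) *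
            Real.exp (-(1 / 4 * ((k + 1 : ℕ) : ℝ)))) :=
          mul_le_mul_of_nonneg_left (exp_neg_floor_half_le_quarter (k + 1)) (by positivity)
      _ = 12 * Real.exp 1 * (L : ℝ) ^ 3 * (((k + 1 : ℕ) : ℝ) * Real.exp (-(1 / 4 * ((k + 1 : ℕ) : ℝ)))) *
            Real.exp (-(1 / 4 * ((k + 1 : ℕ) : ℝ))) := by ring
      _ ≤ 12 * Real.exp 1 * (L : ℝ) ^ 3 * 4 * Real.exp (-(1 / 4 * ((k + 1 : ℕ) : ℝ))) := by
          gcongr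
          exact mul_exp_neg_quarter_le _
      _ = K * Real.exp (-(1 / 4 * ((k + 1 : ℕ) : ℝ))) := by rw [hK]; ring

end Anchor

/-! ### Complex-analysis helpers for the chain continuation -/

/-- The derivative of a holomorphic logarithm: `exp ∘ g = F` on an open set gives `g' = F'/F`. [folklore] -/
theorem deriv_eq_of_exp_eq {U : Set ℂ} (hU : IsOpen U) {g F : ℂ → ℂ} (hg : DifferentiableOn ℂ g U)
    (h : ∀ z ∈ U, exp (g z) = F z) {z : ℂ} (hz : z ∈ U) : deriv g z = deriv F z / F z := by
  have hgz : HasDerivAt g (deriv g z) z := (hg.differentiableAt (hU.mem_nhds hz)).hasDerivAt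
  have h1 : HasDerivAt (fun w => exp (g w)) (exp (g z) * deriv g z) z := hgz.cexp
  have h2 : HasDerivAt F (exp (g z) * deriv g z) z := by
    refine h1.congr_of_eventuallyEq ?_
    filter_upwards [hU.mem_nhds hz] with w hw
    exact (h w hw).symm
  have hF : F z ≠ 0 := by rw [← h z hz]; exact exp_ne_zero _
  rw [h2.deriv, h z hz]
  field_simp

/-- Two holomorphic logarithms of the same function on an open convex set which agree at one point agree
everywhere. [folklore] -/
theorem eqOn_of_exp_eq_of_eq {S : Set ℂ} (hS : IsOpen S) (hSc : Convex ℝ S) {g₁ g₂ F : ℂ → ℂ}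
    (h₁ : DifferentiableOn ℂ g₁ S) (h₂ : DifferentiableOn ℂ g₂ S)
    (he₁ : ∀ z ∈ S, exp (g₁ z) = F z) (he₂ : ∀ z ∈ S, exp (g₂ z) = F z) {a : ℂ} (ha : a ∈ S)
    (hag : g₁ a = g₂ a) : EqOn g₁ g₂ S :=
  hS.eqOn_of_deriv_eq hSc.isPreconnected h₁ h₂
    (fun z hz => by rw [deriv_eq_of_exp_eq hS h₁ he₁ hz, deriv_eq_of_exp_eq hS h₂ he₂ hz]) ha hag

/-- **Borel–Carathéodory, local form.** If `φ` is holomorphic on `ball c R` with `φ c = 0` and `re φ ≤ M`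
(`M > 0`), then near every point `a` of the ball, namely on `ball a ((R - dist a c)/2)`, one has
`‖φ‖ ≤ 4 M R / (R - dist a c)`. [folklore] -/
theorem norm_le_of_re_le_local {φ : ℂ → ℂ} {c : ℂ} {R M : ℝ} (hR : 0 < R) (hM : 0 < M)
    (hφ : DifferentiableOn ℂ φ (ball c R)) (hφc : φ c = 0) (hre : ∀ z ∈ ball c R, (φ z).re ≤ M)
    {a : ℂ} (ha : a ∈ ball c R) {z : ℂ} (hz : z ∈ ball a ((R - dist a c) / 2)) :
    ‖φ z‖ ≤ 4 * M * R / (R - dist a c) := by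
  have hd : dist a c < R := ha
  have hr : 0 < (R - dist a c) / 2 := by linarith
  have hza : dist z a < (R - dist a c) / 2 := hz
  have hzc : ‖z - c‖ ≤ (R + dist a c) / 2 := by
    rw [← dist_eq_norm]
    linarith [dist_triangle z a c]
  have hzR : ‖z - c‖ < R := by linarith
  have hF : DifferentiableOn ℂ (fun w ↦ φ (w + c)) (ball 0 R) := by
    refine hφ.comp (by fun_prop) fun w hw ↦ ?_
    rw [mem_ball_zero_iff] at hw
    exact mem_ball_iff_norm.2 (by simpa using hw)
  have hF₁ : MapsTo (fun w ↦ φ (w + c)) (ball 0 R) {z | z.re ≤ M} := by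
    intro w hw
    rw [mem_ball_zero_iff] at hw
    have : w + c ∈ ball c R := mem_ball_iff_norm.2 (by simpa using hw)
    exact hre _ this
  have hw : z - c ∈ ball (0 : ℂ) R := mem_ball_zero_iff.2 hzR
  have key := Complex.borelCaratheodory_zero hM hF hF₁ hR hw (by simpa using hφc)
  simp only [sub_add_cancel] at key
  calc ‖φ z‖ ≤ 2 * M * ‖z - c‖ / (R - ‖z - c‖) := key
    _ ≤ 2 * M * R / ((R - dist a c) / 2) := by
        have h1 : 2 * M * ‖z - c‖ ≤ 2 * M * R := by nlinarith
        have h2 : (R - dist a c) / 2 ≤ R - ‖z - c‖ := by linarith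
        exact div_le_div₀ (by positivity) h1 hr h2
    _ = 4 * M * R / (R - dist a c) := by
        field_simp
        ring

end Summit.QuantumFields.YangMills.Theorems.TubeZeroFreeChannel

end
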